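import Literature.AnabelianGeometry.EtaleTheta.Thm16SubdagThetaLift
import HarnessLib

/-!
# [EtTh] Theorem 1.6 (ii) — sub-DAG row L11 (a): transport carries `F̈²_α ≅ (K̈α^×)^∧` onto `F̈²_β`
# (`Thm16Sub.TransportPreservesFdd2` DISCHARGED from Prop. 1.5 (ii) and `γ(Δ^tp_{Xα}) = Δ^tp_{Xβ}`; proof-only)

Mochizuki, *The étale theta function and its Frobenioid-theoretic manifestations*, Publ. RIMS **45** (2009),
Thm. 1.6 (ii) p. 24 (printed 250): "`γ` induces an isomorphism `(Δ_Θ)α ⥲ (Δ_Θ)β` that is compatible with the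
surjections `H¹(G_{K̈α}, (Δ_Θ)α) ↠ …` … That is to say, `γ` induces an isomorphism `H¹(G_{K̈α}, (Δ_Θ)α) ⥲
H¹(G_{K̈β}, (Δ_Θ)β)`", proof p. 24 l.79–83: "the fact that `γ` induces an isomorphism `(Δ_Θ)α ⥲ (Δ_Θ)β` is
immediate [in light of the argument used to verify assertion (i)] from the definitions"; Prop. 1.5 (ii) p. 23:
"`F̈² = H¹(G_K̈, Δ_Θ) ⥲ (K̈^×)^∧`" [cite: MochizukiEtTh2009, Thm 1.6 (ii) p.24].

abc-iut cell, layer L2, sub-DAG `plan/L2/SUBDAG-EtTh-Thm16.md` (§K row K3; lineage abc-iut-L6-d5, ONE WRITER),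
PART 9 — PROOF-ONLY. File (C) (`Thm16SubdagTransport`, p417878) reduced abc-iut-L2-t1's `Thm16ii` to two inputs,
the first being the IMAGE statement `Thm16Sub.TransportPreservesFdd2 c h Eα Eβ` («transport carries the
`α`-Kummer image `F̈²_α = κ((K̈α^×)^∧)` onto `F̈²_β`»). THIS FILE DISCHARGES IT from printed inputs:
* `Thm16Sub.exists_thetaTransport_mem_Fdd2` — every class `z ∈ F̈²_α ⊆ H¹((Π^tp_{Ÿα})^Θ, Δ_Θ)` (abc-iut-L2-t1's
  `Fdd2` = kernel of restriction to `(Δ^tp_Ÿ)^Θ`) has a Θ-level transport `z′ ∈ F̈²_β` with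
  `infl z′ = transport(infl z)`: the cocycle `w ↦ γ^Θ(f(γ^Θ⁻¹ w))` of part 8, which stays a coboundary on
  `(Δ^tp_{Ÿβ})^Θ` because `γ` carries `Δ^tp_{Ÿα} = Π^tp_{Ÿα} ∩ Δ^tp_{Xα}` onto `Δ^tp_{Ÿβ}` (Thm 1.6 (i) + row L01
  `hΔ : γ(Δ^tp_{Xα}) = Δ^tp_{Xβ}`, [AbsAnab] Lem. 1.3.8) — built inside the proof, no definition;
* `Thm16Sub.kumRange_map_transport_le` — hence `transport(F̈²_α) ≤ F̈²_β` given Prop. 1.5 (ii) on both sides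
  (`F̈² = range κ`, `Prop15ii.Fdd2_eq`);
* `Thm16Sub.transportPreservesFdd2_of_prop15ii` — and EQUALITY, applying the inclusion to `(γ⁻¹, (γ^Θ)⁻¹)`
  (file (C)'s `companionSymm`, `thm16i_symm`, `transport_transport_symm`);
* `Thm16Sub.thm16ii_of_prop15ii` — Thm. 1.6 (ii) `Thm16ii γ h Eα Eβ Vα Vβ` from a theta companion, `hΔ`,
  Prop 1.5 (ii) (α, β) and the valuation clauses `DeltaPreservesUnitsAndOne` for the induced `δ` ([AbsAnab]
  Prop. 1.2.1 (iv)(vi)(vii)) — file (C)'s `thm16ii_of_inputs` with its first input supplied.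
No `def`, no new `Prop`, nothing asserted; [EtTh] is refereed and undisputed; nothing here bears on [IUTchIII]
Cor. 3.12; typed ≠ proved.
-/

noncomputable section

namespace Literature.AnabelianGeometry.EtaleTheta

open Literature.AnabelianGeometry.SemiGraphs

namespace Thm16Sub

variable {p : ℕ} [Fact p.Prime] {Dα Dβ : ThetaSetting p} {γ : Dα.PiTemp ≃ₜ* Dβ.PiTemp}

/-- `γ^Θ⁻¹` carries `(Δ^tp_{Ÿβ})^Θ` into `(Δ^tp_{Ÿα})^Θ` (Thm 1.6 (i) + `γ(Δ^tp_{Xα}) = Δ^tp_{Xβ}` + the companion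
square). [cite: MochizukiEtTh2009, Thm 1.6 (i) p.24] -/
theorem thetaIso_symm_mem_DtpYddTheta (h : ThetaSetting.Thm16i γ) (c : ThetaSetting.ThetaCompanion γ)
    (hΔ : Dα.DeltaTemp.map γ.toMulEquiv.toMonoidHom = Dβ.DeltaTemp)
    {w : Dβ.GtpTheta} (hw : w ∈ (Dβ.DtpYddN 1).map Dβ.toTheta) :
    c.thetaIso.toMulEquiv.symm w ∈ (Dα.DtpYddN 1).map Dα.toTheta := by
  obtain ⟨y, hy, rfl⟩ := hw
  have hyY : y ∈ Dβ.GtpYdd := (inf_le_left : Dβ.DtpYddN 1 ≤ Dβ.GtpYddN 1) hy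
  have hyΔ : y ∈ Dβ.DeltaTemp := (inf_le_right : Dβ.DtpYddN 1 ≤ Dβ.DeltaTemp) hy
  have hΔ' : γ.toMulEquiv.symm y ∈ Dα.DeltaTemp := by
    have : y ∈ Dα.DeltaTemp.map γ.toMulEquiv.toMonoidHom := by rw [hΔ]; exact hyΔ
    obtain ⟨x, hx, hxy⟩ := this
    have : γ.toMulEquiv.symm y = x := by
      rw [← hxy]; exact γ.toMulEquiv.symm_apply_apply x
    rw [this]; exact hx
  refine ⟨γ.toMulEquiv.symm y, ⟨ThetaSetting.symm_mem_GtpYdd h ⟨y, hyY⟩, hΔ'⟩, ?_⟩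
  exact (thetaIso_symm_toTheta c y).symm

/-- **Θ-level transport of an `F̈²`-class stays in `F̈²`**: for `z ∈ F̈²_α` (restriction to `(Δ^tp_{Ÿα})^Θ`
trivial) there is `z′ ∈ F̈²_β` with `infl z′ = transport(infl z)` — the cocycle `w ↦ γ^Θ(f(γ^Θ⁻¹ w))`, whose
restriction to `(Δ^tp_{Ÿβ})^Θ` is the coboundary of `γ^Θ` of the element bounding `f` on `(Δ^tp_{Ÿα})^Θ`.
[cite: MochizukiEtTh2009, Thm 1.6 (ii) p.24] -/
theorem exists_thetaTransport_mem_Fdd2 (h : ThetaSetting.Thm16i γ) (c : ThetaSetting.ThetaCompanion γ)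
    (hΔ : Dα.DeltaTemp.map γ.toMulEquiv.toMonoidHom = Dβ.DeltaTemp)
    {z : Dα.H1Theta (Dα.GtpYdd.map Dα.toTheta)}
    (hz : z ∈ (ThetaSetting.Fdd2 : Subgroup (Dα.H1Theta (Dα.GtpYdd.map Dα.toTheta)))) :
    ∃ z' : Dβ.H1Theta (Dβ.GtpYdd.map Dβ.toTheta),
      z' ∈ (ThetaSetting.Fdd2 : Subgroup (Dβ.H1Theta (Dβ.GtpYdd.map Dβ.toTheta))) ∧
      Dβ.inflTheta Dβ.GtpYdd z' = ThetaSetting.transport c h (Dα.inflTheta Dα.GtpYdd z) := by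
  obtain ⟨f, rfl⟩ := QuotientGroup.mk_surjective z
  set θ := c.thetaIso.toMulEquiv with hθ
  have hθc : Continuous fun w : Dβ.GtpTheta => θ.symm w := c.thetaIso.continuous_invFun
  -- the Θ-level transported cocycle (as in part 8)
  let g : ↥(Dβ.GtpYdd.map Dβ.toTheta) → ↥Dβ.DeltaTheta := fun w =>
    ⟨θ (f.1 ⟨θ.symm w.1, thetaIso_symm_mem_GtpYddTheta h c w.2⟩).1, c.apply_mem _⟩
  have hg_apply : ∀ w : ↥(Dβ.GtpYdd.map Dβ.toTheta),
      ((g w : Dβ.DeltaTheta) : Dβ.GtpTheta) =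
        θ (f.1 ⟨θ.symm w.1, thetaIso_symm_mem_GtpYddTheta h c w.2⟩).1 := fun w => rfl
  have hg : g ∈ contCocycles (MonoidHom.id Dβ.GtpTheta) Dβ.DeltaTheta (Dβ.GtpYdd.map Dβ.toTheta) := by
    refine ⟨?_, fun u w => ?_⟩
    · apply continuous_induced_rng.2
      change Continuous fun w : ↥(Dβ.GtpYdd.map Dβ.toTheta) =>
        (θ (f.1 ⟨θ.symm w.1, thetaIso_symm_mem_GtpYddTheta h c w.2⟩).1 : Dβ.GtpTheta)
      exact (map_continuous c.thetaIso).comp (continuous_subtype_val.comp (f.2.1.comp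
        ((hθc.comp continuous_subtype_val).subtype_mk _)))
    · have huw : (⟨θ.symm (u * w).1, thetaIso_symm_mem_GtpYddTheta h c (u * w).2⟩ :
            ↥(Dα.GtpYdd.map Dα.toTheta)) =
          ⟨θ.symm u.1, thetaIso_symm_mem_GtpYddTheta h c u.2⟩ *
            ⟨θ.symm w.1, thetaIso_symm_mem_GtpYddTheta h c w.2⟩ := by
        apply Subtype.ext
        simp only [Subgroup.coe_mul, MulMemClass.mk_mul_mk, map_mul]
      apply Subtype.ext
      rw [Subgroup.coe_mul, hg_apply, hg_apply, huw, f.2.2]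
      simp only [Subgroup.coe_mul, MulAut.conjNormal_apply, MonoidHom.id_apply, map_mul, map_inv,
        MulEquiv.apply_symm_apply, hg_apply]
  refine ⟨QuotientGroup.mk ⟨g, hg⟩, ?_, ?_⟩
  · -- `g` restricted to `(Δ^tp_{Ÿβ})^Θ` is a coboundary
    have hle : (Dα.DtpYddN 1).map Dα.toTheta ≤ Dα.GtpYdd.map Dα.toTheta := Subgroup.map_mono inf_le_left
    have hres : (QuotientGroup.mk (ContH1.resCocycle (MonoidHom.id Dα.GtpTheta) Dα.DeltaTheta hle f) :
        Dα.H1Theta ((Dα.DtpYddN 1).map Dα.toTheta)) = QuotientGroup.mk 1 := by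
      have := (MonoidHom.mem_ker).mp hz
      exact this
    obtain ⟨a, ha⟩ := ContH1.exists_coboundary_of_mk_eq _ _ hres
    -- so `f(k) = a · (k a k⁻¹)⁻¹` on `(Δ^tp_{Ÿα})^Θ`
    have hfk : ∀ k : ↥((Dα.DtpYddN 1).map Dα.toTheta),
        (f.1 ⟨k.1, hle k.2⟩ : Dα.GtpTheta) = a.1 * (k.1 * a.1 * k.1⁻¹)⁻¹ := by
      intro k
      have hk := ha k
      -- `hk : 1 = f k * (conj_k a * a⁻¹)`
      have hk' : f.1 ⟨k.1, hle k.2⟩ = (MulAut.conjNormal ((MonoidHom.id Dα.GtpTheta) (k : Dα.GtpTheta)) a * a⁻¹)⁻¹ :=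
        eq_inv_of_mul_eq_one_left hk.symm
      rw [hk']
      simp only [mul_inv_rev, inv_inv, Subgroup.coe_mul, Subgroup.coe_inv, MulAut.conjNormal_apply,
        MonoidHom.id_apply]
    apply (MonoidHom.mem_ker).mpr
    change (QuotientGroup.mk (ContH1.resCocycle (MonoidHom.id Dβ.GtpTheta) Dβ.DeltaTheta
        (Subgroup.map_mono inf_le_left) ⟨g, hg⟩) : Dβ.H1Theta ((Dβ.DtpYddN 1).map Dβ.toTheta)) = 1
    rw [QuotientGroup.eq_one_iff, Subgroup.mem_subgroupOf, mem_contCoboundaries_iff]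
    refine ⟨⟨θ a.1, c.apply_mem a⟩⁻¹, funext fun k => Subtype.ext ?_⟩
    have hkα : θ.symm k.1 ∈ (Dα.DtpYddN 1).map Dα.toTheta := thetaIso_symm_mem_DtpYddTheta h c hΔ k.2
    have hval := hfk ⟨θ.symm k.1, hkα⟩
    change ((g ⟨k.1, _⟩ : Dβ.DeltaTheta) : Dβ.GtpTheta) = _
    rw [hg_apply]
    change θ (f.1 ⟨θ.symm k.1, _⟩).1 = _
    rw [hval]
    -- both sides equal `θ(a) · (k θ(a)⁻¹ k⁻¹)`, up to commuting two elements of the abelian `(Δ_Θ)β`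
    have hXmem : k.1 * (θ a.1)⁻¹ * k.1⁻¹ ∈ Dβ.DeltaTheta :=
      (inferInstance : Dβ.DeltaTheta.Normal).conj_mem _ (Dβ.DeltaTheta.inv_mem (c.apply_mem a)) k.1
    have hcomm : θ a.1 * (k.1 * (θ a.1)⁻¹ * k.1⁻¹) = k.1 * (θ a.1)⁻¹ * k.1⁻¹ * θ a.1 :=
      Dβ.ker_thetaToEll_comm (θ a.1) (c.apply_mem a) _ hXmem
    have hinv : (k.1 * θ a.1 * k.1⁻¹)⁻¹ = k.1 * (θ a.1)⁻¹ * k.1⁻¹ := by group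
    simp only [map_mul, map_inv, MulEquiv.apply_symm_apply, Subgroup.coe_mul, Subgroup.coe_inv,
      MulAut.conjNormal_apply, MonoidHom.id_apply, inv_inv]
    rw [hinv, hcomm]
  · -- inflation of `g` IS the transported cocycle (verbatim as in part 8)
    change (QuotientGroup.mk (ContH1.inflCocycle Dβ.DeltaTheta Dβ.toTheta Dβ.continuous_toTheta le_rfl
        ⟨g, hg⟩) : Dβ.H1 Dβ.GtpYdd) =
      QuotientGroup.mk (ThetaSetting.transportCocycle c h
        (ContH1.inflCocycle Dα.DeltaTheta Dα.toTheta Dα.continuous_toTheta le_rfl f))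
    congr 1
    apply Subtype.ext
    funext y
    apply Subtype.ext
    change ((g ⟨Dβ.toTheta y.1, _⟩ : Dβ.DeltaTheta) : Dβ.GtpTheta) =
      c.thetaIso (f.1 ⟨Dα.toTheta (γ.toMulEquiv.symm y.1), _⟩).1
    rw [hg_apply]
    change θ (f.1 ⟨θ.symm (Dβ.toTheta y.1), _⟩).1 = θ (f.1 ⟨Dα.toTheta (γ.toMulEquiv.symm y.1), _⟩).1
    exact congrArg (fun u : ↥(Dα.GtpYdd.map Dα.toTheta) => θ (f.1 u).1)
      (Subtype.ext (thetaIso_symm_toTheta c y.1))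

/-- **`transport(F̈²_α) ≤ F̈²_β`** on the images of the Kummer injections in `H¹(Π^tp_Ÿ, Δ_Θ)`, given Prop 1.5 (ii)
on both sides (`F̈² = κ((K̈^×)^∧)`). [cite: MochizukiEtTh2009, Thm 1.6 (ii) p.24] -/
theorem kumRange_map_transport_le (h : ThetaSetting.Thm16i γ) (c : ThetaSetting.ThetaCompanion γ)
    (hΔ : Dα.DeltaTemp.map γ.toMulEquiv.toMonoidHom = Dβ.DeltaTemp)
    (Eα : Dα.KummerData) (Eβ : Dβ.KummerData) (hCα : Dα.Compat) (hCβ : Dβ.Compat)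
    (h15α : ThetaSetting.Prop15ii Eα hCα) (h15β : ThetaSetting.Prop15ii Eβ hCβ) :
    (kumRange Eα).map (ThetaSetting.transport c h) ≤ kumRange Eβ := by
  rintro _ ⟨_, ⟨a, rfl⟩, rfl⟩
  have hz : Eα.kumYdd a ∈ (ThetaSetting.Fdd2 : Subgroup (Dα.H1Theta (Dα.GtpYdd.map Dα.toTheta))) := by
    rw [h15α.Fdd2_eq]; exact ⟨a, rfl⟩
  obtain ⟨z', hz', hinfl⟩ := exists_thetaTransport_mem_Fdd2 h c hΔ hz
  rw [h15β.Fdd2_eq] at hz'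
  obtain ⟨b, rfl⟩ := hz'
  exact ⟨b, hinfl⟩

/-- **Row L11 (a) DISCHARGED: `TransportPreservesFdd2 c h Eα Eβ`** — transport carries `F̈²_α = κ((K̈α^×)^∧)` ONTO
`F̈²_β` — from a theta companion, Thm 1.6 (i), `γ(Δ^tp_{Xα}) = Δ^tp_{Xβ}` and Prop 1.5 (ii) on both sides (the
reverse inclusion by the same argument for `(γ⁻¹, (γ^Θ)⁻¹)` and file (C)'s `transport_transport_symm`).
[cite: MochizukiEtTh2009, Thm 1.6 (ii) p.24] -/
theorem transportPreservesFdd2_of_prop15ii (h : ThetaSetting.Thm16i γ) (c : ThetaSetting.ThetaCompanion γ)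
    (hΔ : Dα.DeltaTemp.map γ.toMulEquiv.toMonoidHom = Dβ.DeltaTemp)
    (Eα : Dα.KummerData) (Eβ : Dβ.KummerData) (hCα : Dα.Compat) (hCβ : Dβ.Compat)
    (h15α : ThetaSetting.Prop15ii Eα hCα) (h15β : ThetaSetting.Prop15ii Eβ hCβ) :
    TransportPreservesFdd2 c h Eα Eβ := by
  refine le_antisymm (kumRange_map_transport_le h c hΔ Eα Eβ hCα hCβ h15α h15β) ?_
  -- (hΔ) for `γ⁻¹`
  have hΔ' : Dβ.DeltaTemp.map γ.symm.toMulEquiv.toMonoidHom = Dα.DeltaTemp := by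
    rw [← hΔ, Subgroup.map_map]
    convert Subgroup.map_id _
    ext x
    exact γ.symm_apply_apply x
  intro y hy
  have hy' : ThetaSetting.transport (companionSymm c) (thm16i_symm h) y ∈ kumRange Eα :=
    kumRange_map_transport_le (thm16i_symm h) (companionSymm c) hΔ' Eβ Eα hCβ hCα h15β h15α ⟨y, hy, rfl⟩
  exact ⟨_, hy', transport_transport_symm c h y⟩

/-- **[EtTh] Thm. 1.6 (ii) from print-shaped inputs**: `Thm16ii γ h Eα Eβ Vα Vβ` from a theta companion `c`,
`γ(Δ^tp_{Xα}) = Δ^tp_{Xβ}` (row L01, [AbsAnab] Lem. 1.3.8), Prop 1.5 (ii) on both sides (⟹ row L11 (a), this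
file) and the valuation clauses for the induced `δ` (row L11 (b)(c), [AbsAnab] Prop. 1.2.1 (iv)(vi)(vii)) —
file (C)'s `thm16ii_of_inputs` with its image input discharged. [cite: MochizukiEtTh2009, Thm 1.6 (ii) p.24] -/
theorem thm16ii_of_prop15ii (c : ThetaSetting.ThetaCompanion γ) (h : ThetaSetting.Thm16i γ)
    (hΔ : Dα.DeltaTemp.map γ.toMulEquiv.toMonoidHom = Dβ.DeltaTemp)
    (Eα : Dα.KummerData) (Eβ : Dβ.KummerData) (hCα : Dα.Compat) (hCβ : Dβ.Compat)
    (h15α : ThetaSetting.Prop15ii Eα hCα) (h15β : ThetaSetting.Prop15ii Eβ hCβ)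
    (Vα : ThetaSetting.ValuationHatData Dα Eα) (Vβ : ThetaSetting.ValuationHatData Dβ Eβ)
    (hV : ∀ δ : Eα.KddHat ≃* Eβ.KddHat,
      (∀ a, ThetaSetting.transport c h (Dα.inflTheta Dα.GtpYdd (Eα.kumYdd a)) =
        Dβ.inflTheta Dβ.GtpYdd (Eβ.kumYdd (δ a))) → DeltaPreservesUnitsAndOne δ Vα Vβ) :
    ThetaSetting.Thm16ii γ h Eα Eβ Vα Vβ :=
  thm16ii_of_inputs c h Eα Eβ Vα Vβ (transportPreservesFdd2_of_prop15ii h c hΔ Eα Eβ hCα hCβ h15α h15β) hV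

end Thm16Sub

end Literature.AnabelianGeometry.EtaleTheta

end
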